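import Literature.Claims.NS.Silvente2025
import Mathlib.Analysis.SpecialFunctions.Log.Basic
import Mathlib.Analysis.SpecialFunctions.Sqrt
import HarnessLib

/-!
# C104 `Silvente2025` — refutation certificates against the claim skeleton `Literature.Claims.NS.Silvente2025`

Text of record: E. Vidal Silvente, «A Dual Demonstration of Navier–Stokes Global Regularity via
Logical–Fractal Resonance», Zenodo 17315183 v6 (2025), 17 pp. (PDF page = printed page). Skeleton p488140
(typist-5 g3): `ClaimedTheorem` ↔ Clay (A) (`claimedTheorem_iff_clayA`, rfl); all-data route
`claim_of_steps : Step_3a C → Step_3b C → ClaimedTheorem`; small-data route `claimedSmall_of_step_2 :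
Step_2 C → ClaimedSmall C` (Δ4 only). The print states its two «Grönwall» steps at the SCALAR grain
(«Suppose E(t) satisfies … Then …», p.16 l.1; p.11 l.9–17), and that is the grain refuted here.

Kernel content — typist-5 g3's kit (claims/Silvente2025/typist5-killkit-SoloRefuteSilvente2025.lean,
sha16 e3605314f9f5c82a) adopted by the refuter of record (refuter-3); the Step-3b profile lemmas are
factored out of the kit's proof so that the vacuity of Step 3a can be recorded (proof content unchanged):

* `not_Step_2` (kit) — the small-data GLOBAL closure (p.10 l.68–69 «if E(0) < ε … E(t) remains finite for
  all t ≥ 0»; [Resonant Grönwall Estimate] p.16 l.1–16 «… extends this globally»; App. A p.17 l.11) is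
  FALSE for every `C > 0`: for every `ε > 0` the admissible pair `E(t) = (√(ε/2)(1 + at))²`,
  `a = ½C√(ε/2)`, `D ≡ 0` obeys `E′ + 2νD ≤ C·E√E` on `[0,∞)`, has `E(0) = ε/2 < ε`, and is unbounded.
* `not_Step_3b` (kit) — the «Resonant Grönwall» inference (p.11 l.15–17 «Then E(t) remains uniformly
  bounded for all t ≥ 0, even without assuming smallness of E(0)») is FALSE for every `C > 0`:
  `E(t) = (1 + at)²`, `a = aOf C = min(1/2, C²/64, C/4)`, `D ≡ 0` obeys the refined inequality on
  `[0,∞)` for EVERY `ν` (`refinedIneq_quad`: the damping `1 + log(1 + I[E](t))` grows like `log t`,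
  `E√E/E′` like `t²`) and is unbounded.
* `step_3a_vacuous` (refuter-3) — Step 3a AS TYPED (`∃ E D, Route C ν u₀ E D ∧ RefinedIneq C ν E D`)
  HOLDS for every `C > 0`, for the wrong reason: the same unbounded profile is an admissible pair obeying
  both laws (`lawIneq_quad`, `refinedIneq_quad`), and its unboundedness makes the `Route.bridge`
  premise `BoundedOn0 E` false, so the bridge holds vacuously. Hence `claimedTheorem_of_step_3b`: as
  typed, ALL content of the all-data route sits in Step 3b — which is false. (At the print level Step 3a
  is the «Suppose» of p.11 l.9–14, derived nowhere: an unfilled gap for the flow's actual weighted energy.)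

WHAT THIS IS NOT: not a claim about NS regularity or blow-up; not a claim about any author beyond the
typed locator.
-/

-- the cell's Theorems namespace repeats the summit name (convention); silence the duplicate-namespace linter
set_option linter.dupNamespace false

noncomputable section

open Set Real MeasureTheory intervalIntegral
open Literature.Claims.NS.Silvente2025

namespace Summit.NavierStokesRegularity.NavierStokesRegularity.Theorems.Silvente2025

/-! ### Step 2 (small-data global closure) is false -/

/-- The quadratic profile `E(t) = (s(1 + a t))²`. [folklore] -/
def quadProfile (s a : ℝ) (t : ℝ) : ℝ := (s * (1 + a * t)) ^ 2

/-- Derivative of the quadratic profile. [folklore] -/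
theorem hasDerivAt_quadProfile (s a t : ℝ) :
    HasDerivAt (quadProfile s a) (2 * (s * (1 + a * t)) * (s * a)) t := by
  have h1 : HasDerivAt (fun t => s * (1 + a * t)) (s * a) t := by
    have := ((hasDerivAt_id t).const_mul a).const_add 1
    simpa using this.const_mul s
  have e : quadProfile s a = fun t => (s * (1 + a * t)) * (s * (1 + a * t)) :=
    funext fun t => sq _
  rw [e]
  exact (h1.mul h1).congr_deriv (by ring)

/-- `E′(t) = 2 s(1 + at)·(s a)`. [folklore] -/
theorem deriv_quadProfile (s a t : ℝ) :
    deriv (quadProfile s a) t = 2 * (s * (1 + a * t)) * (s * a) :=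
  (hasDerivAt_quadProfile s a t).deriv

/-- The profile is differentiable. [folklore] -/
theorem differentiable_quadProfile (s a : ℝ) : Differentiable ℝ (quadProfile s a) :=
  fun t => (hasDerivAt_quadProfile s a t).differentiableAt

/-- `√E(t) = s(1 + at)` for `s, a, t ≥ 0`. [folklore] -/
theorem sqrt_quadProfile {s a t : ℝ} (hs : 0 ≤ s) (ha : 0 ≤ a) (ht : 0 ≤ t) :
    Real.sqrt (quadProfile s a t) = s * (1 + a * t) := by
  unfold quadProfile
  exact Real.sqrt_sq (by positivity)

/-- The quadratic profile is unbounded on `[0,∞)` when `s, a > 0`. [folklore] -/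
theorem not_boundedOn0_quadProfile {s a : ℝ} (hs : 0 < s) (ha : 0 < a) :
    ¬ BoundedOn0 (quadProfile s a) := by
  rintro ⟨M, hM⟩
  set t : ℝ := (|M| + 1) / (s ^ 2 * a) with ht
  have hpos : 0 < s ^ 2 * a := by positivity
  have ht0 : 0 ≤ t := by rw [ht]; positivity
  have h1 := hM t ht0
  have h2 : s ^ 2 * a * t = |M| + 1 := by
    rw [ht]; field_simp
  have h3 : quadProfile s a t ≥ s ^ 2 * (a * t) := by
    unfold quadProfile
    nlinarith [mul_nonneg (le_of_lt ha) ht0, sq_nonneg (a * t), sq_nonneg s]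
  have h4 : |M| + 1 ≤ quadProfile s a t := by nlinarith
  linarith [le_abs_self M]

/-- **Step 2 is false for every `C > 0`**: no universal smallness threshold makes the law
`E′ + 2νD ≤ C E^{3/2}` propagate a bound to all `t ≥ 0`. Countermodel for a given `ε`:
`E(t) = (√(ε/2)(1 + at))²`, `a = ½C√(ε/2)`, `D ≡ 0`, `ν = 1`.
[cite: Silvente2025, p.10 l.68–69; [Resonant Grönwall Estimate] p.16 l.1–16; App. A p.17 l.2–12] -/
theorem not_Step_2 {C : ℝ} (hC : 0 < C) : ¬ Step_2 C := by
  rintro ⟨ε, hε, h⟩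
  set s : ℝ := Real.sqrt (ε / 2) with hs
  have hs0 : 0 < s := Real.sqrt_pos.2 (by linarith)
  set a : ℝ := C * s / 2 with ha
  have ha0 : 0 < a := by positivity
  have hadm : Admissible (quadProfile s a) (fun _ => 0) :=
    ⟨differentiable_quadProfile s a, fun t _ => by unfold quadProfile; positivity, fun _ _ => le_rfl⟩
  have hlaw : LawIneq C 1 (quadProfile s a) (fun _ => 0) := by
    intro t ht
    rw [deriv_quadProfile, sqrt_quadProfile hs0.le ha0.le ht, mul_zero, add_zero]
    unfold quadProfile
    have h1 : 1 ≤ 1 + a * t := by nlinarith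
    have hx : 0 ≤ s * (1 + a * t) := by positivity
    -- LHS = C s³ (1+at), RHS = C s³ (1+at)³
    have key : 2 * (s * (1 + a * t)) * (s * a) = C * s ^ 3 * (1 + a * t) := by
      rw [ha]; ring
    rw [key]
    have h2 : (1 + a * t) ≤ (1 + a * t) ^ 3 := by
      nlinarith [h1, mul_nonneg (by linarith : (0:ℝ) ≤ 1 + a * t) (by linarith : (0:ℝ) ≤ 1 + a * t)]
    have h3 : 0 ≤ C * s ^ 3 := by positivity
    calc C * s ^ 3 * (1 + a * t) ≤ C * s ^ 3 * (1 + a * t) ^ 3 := by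
          exact mul_le_mul_of_nonneg_left h2 h3
      _ = C * ((s * (1 + a * t)) ^ 2 * (s * (1 + a * t))) := by ring
  have hE0 : quadProfile s a 0 < ε := by
    unfold quadProfile
    rw [mul_zero, add_zero, mul_one, hs, Real.sq_sqrt (by linarith)]
    linarith
  exact not_boundedOn0_quadProfile hs0 ha0 (h 1 one_pos _ _ hadm hlaw hE0)

/-! ### Step 3b (resonant Grönwall inference) is false -/

/-- `log(1 + x) ≤ 2√(1 + x)` for `x ≥ 0` (from `log y ≤ y − 1`). [folklore] -/
theorem log_one_add_le_two_sqrt {x : ℝ} (hx : 0 ≤ x) : Real.log (1 + x) ≤ 2 * Real.sqrt (1 + x) := by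
  have h1 : 0 < Real.sqrt (1 + x) := Real.sqrt_pos.2 (by linarith)
  have h2 : Real.log (Real.sqrt (1 + x)) ≤ Real.sqrt (1 + x) - 1 := Real.log_le_sub_one_of_pos h1
  have h3 : Real.log (1 + x) = 2 * Real.log (Real.sqrt (1 + x)) := by
    rw [Real.log_sqrt (by linarith)]; ring
  rw [h3]; linarith

/-- The unit-slope-one profile is nonnegative. [folklore] -/
theorem quadProfile_one_nonneg (a t : ℝ) : 0 ≤ quadProfile 1 a t := by
  unfold quadProfile; positivity

/-- The integrand of `I[E]` for `E = (1 + at)²` is continuous. [folklore] -/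
theorem continuous_dampIntegrand (a : ℝ) :
    Continuous fun s => quadProfile 1 a s / (1 + Real.log (1 + quadProfile 1 a s)) := by
  have hq : Continuous (quadProfile 1 a) := by unfold quadProfile; fun_prop
  have hlog : Continuous fun s => Real.log (1 + quadProfile 1 a s) :=
    (continuous_const.add hq).log fun s => by
      show (1 : ℝ) + quadProfile 1 a s ≠ 0
      exact ne_of_gt (by linarith [quadProfile_one_nonneg a s])
  refine hq.div (continuous_const.add hlog) fun s => ?_
  have h0 : 0 ≤ Real.log (1 + quadProfile 1 a s) :=
    Real.log_nonneg (by linarith [quadProfile_one_nonneg a s])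
  exact ne_of_gt (by linarith)

/-- For the profile `E(t) = (1 + at)²` with `a > 0`: `0 ≤ I[E](t) ≤ t·E(t)` for `t ≥ 0` (the integrand is
`≤ E(s) ≤ E(t)` on `[0,t]` since the logarithmic denominator is `≥ 1` and `E` is increasing). [folklore] -/
theorem dampI_quad_bounds {a : ℝ} (ha : 0 < a) {t : ℝ} (ht : 0 ≤ t) :
    0 ≤ dampI (quadProfile 1 a) t ∧ dampI (quadProfile 1 a) t ≤ t * quadProfile 1 a t := by
  unfold dampI
  have hpt : ∀ s ∈ Icc (0:ℝ) t, 0 ≤ quadProfile 1 a s / (1 + Real.log (1 + quadProfile 1 a s)) := by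
    intro s _
    have h0 : 0 ≤ Real.log (1 + quadProfile 1 a s) :=
      Real.log_nonneg (by linarith [quadProfile_one_nonneg a s])
    exact div_nonneg (quadProfile_one_nonneg a s) (by linarith)
  refine ⟨intervalIntegral.integral_nonneg ht hpt, ?_⟩
  have hmono : ∀ s ∈ Icc (0:ℝ) t,
      quadProfile 1 a s / (1 + Real.log (1 + quadProfile 1 a s)) ≤ quadProfile 1 a t := by
    intro s hs
    have h0 : 0 ≤ Real.log (1 + quadProfile 1 a s) :=
      Real.log_nonneg (by linarith [quadProfile_one_nonneg a s])
    have h1 : quadProfile 1 a s / (1 + Real.log (1 + quadProfile 1 a s)) ≤ quadProfile 1 a s :=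
      div_le_self (quadProfile_one_nonneg a s) (by linarith)
    have h2 : quadProfile 1 a s ≤ quadProfile 1 a t := by
      unfold quadProfile
      have hs0 : 0 ≤ s := hs.1
      have hst : s ≤ t := hs.2
      have : 1 + a * s ≤ 1 + a * t := by nlinarith
      have h3 : 0 ≤ 1 + a * s := by nlinarith
      nlinarith [mul_le_mul this this h3 (by linarith)]
    exact h1.trans h2
  calc ∫ s in (0:ℝ)..t, quadProfile 1 a s / (1 + Real.log (1 + quadProfile 1 a s))
      ≤ ∫ _ in (0:ℝ)..t, quadProfile 1 a t :=
        intervalIntegral.integral_mono_on ht ((continuous_dampIntegrand a).intervalIntegrable 0 t)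
          intervalIntegrable_const hmono
    _ = t * quadProfile 1 a t := by rw [intervalIntegral.integral_const, sub_zero, smul_eq_mul]

/-- The rate `a(C) = min(1/2, C²/64, C/4)` of the Step-3b profile. [folklore] -/
def aOf (C : ℝ) : ℝ := min (1/2) (min (C ^ 2 / 64) (C / 4))

/-- `a(C) > 0` for `C > 0`. [folklore] -/
theorem aOf_pos {C : ℝ} (hC : 0 < C) : 0 < aOf C :=
  lt_min (by norm_num) (lt_min (by positivity) (by positivity))

/-- `a(C) ≤ 1/2`. [folklore] -/
theorem aOf_le_half (C : ℝ) : aOf C ≤ 1 / 2 := min_le_left _ _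

/-- `a(C) ≤ C²/64`. [folklore] -/
theorem aOf_le_sq (C : ℝ) : aOf C ≤ C ^ 2 / 64 := (min_le_right _ _).trans (min_le_left _ _)

/-- `a(C) ≤ C/4`. [folklore] -/
theorem aOf_le_quarter (C : ℝ) : aOf C ≤ C / 4 := (min_le_right _ _).trans (min_le_right _ _)

/-- The pair `((1 + at)², 0)` is admissible. [folklore] -/
theorem admissible_quad (a : ℝ) : Admissible (quadProfile 1 a) (fun _ => 0) :=
  ⟨differentiable_quadProfile 1 a, fun t _ => quadProfile_one_nonneg a t, fun _ _ => le_rfl⟩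

/-- The profile `E(t) = (1 + a(C)t)²`, `D ≡ 0` obeys the UNREFINED law `E′ + 2νD ≤ C·E√E` on `[0,∞)`
for every `ν` (`2a ≤ C ≤ C(1 + at)²`). [cite: Silvente2025, [Fractal Energy Inequality] p.10 l.62–67] -/
theorem lawIneq_quad {C : ℝ} (hC : 0 < C) (ν : ℝ) : LawIneq C ν (quadProfile 1 (aOf C)) (fun _ => 0) := by
  intro t ht
  have ha0 := aOf_pos hC
  have ha3 := aOf_le_quarter C
  set a := aOf C with ha
  rw [deriv_quadProfile, sqrt_quadProfile zero_le_one ha0.le ht, mul_zero, add_zero]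
  unfold quadProfile
  have hx : 1 ≤ 1 + a * t := by nlinarith [mul_nonneg ha0.le ht]
  have h3 : (1 : ℝ) ≤ (1 + a * t) ^ 2 := by nlinarith
  calc 2 * (1 * (1 + a * t)) * (1 * a) = (2 * a) * (1 + a * t) := by ring
    _ ≤ (C * (1 + a * t) ^ 2) * (1 + a * t) := by
        apply mul_le_mul_of_nonneg_right _ (by linarith)
        nlinarith
    _ = C * ((1 * (1 + a * t)) ^ 2 * (1 * (1 + a * t))) := by ring

/-- The profile `E(t) = (1 + a(C)t)²`, `D ≡ 0` obeys the REFINED inequality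
`E′ + 2νD ≤ C·E√E/(1 + log(1 + I[E]))` on `[0,∞)` for every `ν` (typist-5 g3's estimate: `log(1 + I) ≤
2√(1 + tE)` and `4a√(1 + tE) ≤ (C/2)E`). [cite: Silvente2025, [Resonant Grönwall Inequality] p.11 l.9–14] -/
theorem refinedIneq_quad {C : ℝ} (hC : 0 < C) (ν : ℝ) :
    RefinedIneq C ν (quadProfile 1 (aOf C)) (fun _ => 0) := by
  intro t ht
  have ha0 := aOf_pos hC
  have ha1 := aOf_le_half C
  have ha2 := aOf_le_sq C
  have ha3 := aOf_le_quarter C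
  set a := aOf C with ha
  obtain ⟨hI0, hIle⟩ := dampI_quad_bounds ha0 ht
  set I := dampI (quadProfile 1 a) t with hI
  set q := quadProfile 1 a t with hq
  have hq1 : 1 ≤ q := by
    rw [hq]; unfold quadProfile; nlinarith [mul_nonneg ha0.le ht]
  have hq0 : 0 ≤ q := by linarith
  have hlog0 : 0 ≤ Real.log (1 + I) := Real.log_nonneg (by linarith)
  have hden : 0 < 1 + Real.log (1 + I) := by linarith
  rw [deriv_quadProfile, sqrt_quadProfile zero_le_one ha0.le ht, mul_zero, add_zero,
    le_div_iff₀ hden]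
  -- goal: 2(1+at)·a · (1 + log(1+I)) ≤ C (q · (1+at)),  q = (1+at)²
  have hx : 0 < 1 + a * t := by nlinarith [mul_nonneg ha0.le ht]
  have hqx : q = (1 + a * t) ^ 2 := by rw [hq]; unfold quadProfile; ring
  -- logarithm ≤ 2√(1+I) ≤ 2√(1 + t q)
  have hlog1 : Real.log (1 + I) ≤ 2 * Real.sqrt (1 + t * q) :=
    (log_one_add_le_two_sqrt hI0).trans (by gcongr)
  -- 4a√(1 + tq) ≤ (C/2) q
  have hkey : a * (1 + t * q) ≤ q ^ 2 := by
    have h1 : q * (1 + 2 * a * t) ≤ q * q := by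
      apply mul_le_mul_of_nonneg_left _ hq0
      rw [hqx]; nlinarith [mul_nonneg ha0.le ht]
    nlinarith [mul_nonneg (mul_nonneg ha0.le ht) hq0]
  have hsq : (4 * a) ^ 2 * (1 + t * q) ≤ (C / 2 * q) ^ 2 := by
    have h16 : (4 * a) ^ 2 ≤ a * C ^ 2 / 4 := by nlinarith
    have h1tq : 0 ≤ 1 + t * q := by nlinarith [mul_nonneg ht hq0]
    calc (4 * a) ^ 2 * (1 + t * q) ≤ a * C ^ 2 / 4 * (1 + t * q) :=
          mul_le_mul_of_nonneg_right h16 h1tq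
      _ = C ^ 2 / 4 * (a * (1 + t * q)) := by ring
      _ ≤ C ^ 2 / 4 * q ^ 2 := by gcongr
      _ = (C / 2 * q) ^ 2 := by ring
  have hroot : 4 * a * Real.sqrt (1 + t * q) ≤ C / 2 * q := by
    have h4a : 0 ≤ 4 * a := by linarith
    have hCq : 0 ≤ C / 2 * q := by positivity
    calc 4 * a * Real.sqrt (1 + t * q)
        = Real.sqrt ((4 * a) ^ 2) * Real.sqrt (1 + t * q) := by rw [Real.sqrt_sq h4a]
      _ = Real.sqrt ((4 * a) ^ 2 * (1 + t * q)) := by rw [Real.sqrt_mul (sq_nonneg _)]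
      _ ≤ Real.sqrt ((C / 2 * q) ^ 2) := Real.sqrt_le_sqrt hsq
      _ = C / 2 * q := Real.sqrt_sq hCq
  have h2a : 2 * a ≤ C / 2 * q := by nlinarith
  -- assemble: 2a(1+at)(1 + log(1+I)) ≤ (1+at)(2a + 4a√(1+tq)) ≤ (1+at)·C q
  have hsqrt0 : 0 ≤ Real.sqrt (1 + t * q) := Real.sqrt_nonneg _
  calc 2 * (1 * (1 + a * t)) * (1 * a) * (1 + Real.log (1 + I))
      ≤ 2 * (1 * (1 + a * t)) * (1 * a) * (1 + 2 * Real.sqrt (1 + t * q)) := by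
        apply mul_le_mul_of_nonneg_left (by linarith) (by positivity)
    _ = (1 + a * t) * (2 * a + 4 * a * Real.sqrt (1 + t * q)) := by ring
    _ ≤ (1 + a * t) * (C / 2 * q + C / 2 * q) := by
        apply mul_le_mul_of_nonneg_left (add_le_add h2a hroot) hx.le
    _ = C * (q * (1 * (1 + a * t))) := by ring

/-- **Step 3b is false for every `C > 0`**: the «refined» inequality with its logarithmic damping does
not bound `E`. Countermodel: `E(t) = (1 + a(C)t)²`, `D ≡ 0`, `ν = 1`.
[cite: Silvente2025, [Resonant Grönwall Inequality] p.11 l.3–17; §8.1 p.14 l.2–4] -/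
theorem not_Step_3b {C : ℝ} (hC : 0 < C) : ¬ Step_3b C := fun h =>
  not_boundedOn0_quadProfile one_pos (aOf_pos hC)
    (h 1 one_pos _ _ (admissible_quad (aOf C)) (refinedIneq_quad hC 1))

/-! ### Step 3a as typed is vacuous; all content of the all-data route sits in Step 3b -/

/-- **Step 3a AS TYPED holds for every `C > 0` — vacuously**: for every `ν` and every datum, the
unbounded profile `((1 + a(C)t)², 0)` is an admissible pair obeying both the law and the refined
inequality, and its unboundedness falsifies the premise `BoundedOn0 E` of `Route.bridge`, so the bridge
holds trivially. (The print's Step 3a — «Suppose the evolution satisfies the refined inequality»,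
p.11 l.9–14, for the flow's actual weighted energy — is derived nowhere; the typed `∃ E D` does not pin
`E` to the flow.) [cite: Silvente2025, [Resonant Grönwall Inequality] p.11 l.9–14] -/
theorem step_3a_vacuous {C : ℝ} (hC : 0 < C) : Step_3a C := by
  intro ν _ u₀ _
  refine ⟨quadProfile 1 (aOf C), fun _ => 0, ⟨admissible_quad (aOf C), lawIneq_quad hC ν, ?_⟩,
    refinedIneq_quad hC ν⟩
  intro hb
  exact (not_boundedOn0_quadProfile one_pos (aOf_pos hC) hb).elim

/-- Hence, as typed, Step 3b ALONE would give the headline (and it is false: `not_Step_3b`).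
[cite: Silvente2025, p.11 l.3–22; §8 p.13 l.9–10] -/
theorem claimedTheorem_of_step_3b {C : ℝ} (hC : 0 < C) (h : Step_3b C) : ClaimedTheorem :=
  claim_of_steps (step_3a_vacuous hC) h

end Summit.NavierStokesRegularity.NavierStokesRegularity.Theorems.Silvente2025

-- WHAT THIS IS NOT: not a claim about NS regularity or blow-up; not a claim about any author beyond the typed locator.
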